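import Mathlib
import Summits.KontsevichZagierPeriods.Zeta5Search.Families.DualConstantTerm
import HarnessLib

/-!
# ζ(5) search — Families: the coefficients of the dual span product in CLOSED FORM (a triple binomial sum)

HONEST FRAMING: systematic search; no irrationality claim unless certified.  Cell `pub-zeta5`, certifier 2
(cert-2 g7, 2026-08-21).  Identities and inequalities between integers only; nothing about `ζ(5)`; no conjecture
node is used or asserted here.  Companion file `Families/DualConstantTermSum` draws the consequences for P2 g6's
`dualConstantTerm` and CONJECTURE D-exact (`Families/DualConstantTerm`).

PRIOR ART: the constant term `[g^B] dualSpanProd A` is the "torus period" of McCarthy–Osburn–Straub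
[MOS20, §3.2] (Math. Proc. Camb. Phil. Soc. 168 (2020); arXiv:1705.05586), who obtain binomial-sum forms of such
constant terms by exactly this kind of ordered expansion ("the order in which terms are expanded can have a
considerable influence on the final binomial sum").

CONTENTS (standard axioms only; everything in namespace `…Families.Cellular.DualCT`):
* `coeff_X_add_pow_mul`, `coeff_X_pow_mul_X_add_pow_mul`, `coeff_X_pow_single` — generic coefficient extraction
  for `MvPolynomial σ R`: `[m] ((X i + q)^n · p) = C(n, m i) · [m.erase i] (q^(n − m i) · p)` when `q, p` do not
  involve `X i` [folklore]; the side conditions `i ∉ vars (…)` are discharged syntactically (reducible `apply`);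
* `dualSpanProd_eq_sum` (three binomial splits: `(g₀+g₁+g₂+g₃)^{A₆}` and `(g₀+g₁+g₂)^{A₇}` along `g₀+g₁`,
  `(g₁+⋯+g₅)^{A₁}` along `g₁`), `coeff_term` (extract `g₀, g₁, g₅, g₄, g₃`, read off `g₂`), and
  **`coeff_dualSpanProd : [g^m] dualSpanProd A = ctSum A m`** — a 3-fold sum of products of eight binomial
  coefficients, for EVERY exponent vector `A` and monomial `m`;
* `coeff_dualSpanProd_nonneg` (all coefficients `≥ 0`), `coeff_mul_prod_le_eval₂` (`[m]p · g^m ≤ p(g)` for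
  `p ≥ 0` coefficientwise and `g ≥ 0`), `dualSpanProd_smul` (`dualSpanProd (n·A) = (dualSpanProd A)ⁿ`).
Exact cross-checks outside the kernel (seat folder `work/dexact/`): `ctSum` agrees with P2's full expansion and
with `|Q|` of [BrownZudilin2022, (17)] on 58 parameter vectors including the record vector
`(8,16,10,15,12,16,18,13)`.
-/

noncomputable section

open MvPolynomial Finset

namespace Summit.KontsevichZagierPeriods.Zeta5Search.Families.Cellular

namespace DualCT

variable {σ R : Type*} [CommSemiring R] [DecidableEq σ]

/-- `i ∉ vars (p * q)` from the factors. [folklore] -/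
theorem notMem_vars_mul {i : σ} {p q : MvPolynomial σ R} (hp : i ∉ p.vars) (hq : i ∉ q.vars) :
    i ∉ (p * q).vars := fun h => by
  rcases Finset.mem_union.mp (vars_mul p q h) with h' | h'
  exacts [hp h', hq h']

omit [DecidableEq σ] in
/-- `i ∉ vars (p ^ n)` from the base (paired with the hypothesis, for chaining). [folklore] -/
theorem notMem_vars_pow_and {i : σ} {p : MvPolynomial σ R} (hp : i ∉ p.vars) (n : ℕ) :
    i ∉ (p ^ n).vars ∧ i ∉ p.vars := ⟨fun h => hp (vars_pow p n h), hp⟩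

/-- `i ∉ vars (p + q)` from the summands. [folklore] -/
theorem notMem_vars_add {i : σ} {p q : MvPolynomial σ R} (hp : i ∉ p.vars) (hq : i ∉ q.vars) :
    i ∉ (p + q).vars := fun h => by
  rcases Finset.mem_union.mp (vars_add_subset p q h) with h' | h'
  exacts [hp h', hq h']

omit [DecidableEq σ] in
/-- `i ∉ vars (X j)` for `i ≠ j` (paired with the hypothesis, for chaining). [folklore] -/
theorem notMem_vars_X_and [Nontrivial R] {i j : σ} (h : i ≠ j) :
    i ∉ (X j : MvPolynomial σ R).vars ∧ i ≠ j := by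
  refine ⟨?_, h⟩
  rw [vars_X]; simpa using h

/-- `m − (m i)·e_i = m.erase i`. [folklore] -/
theorem sub_single_self_eq_erase (m : σ →₀ ℕ) (i : σ) : m - Finsupp.single i (m i) = m.erase i := by
  ext j
  by_cases h : j = i
  · subst h; simp
  · simp [Ne.symm h, Finsupp.erase_ne h]

/-- **Coefficient extraction of one variable occurring in a single factor.**  If `q` and `p` do not involve `X i`,
then `[m] ((X i + q)^n · p) = C(n, m i) · [m.erase i] (q^(n − m i) · p)`. [folklore] -/
theorem coeff_X_add_pow_mul (i : σ) {q p : MvPolynomial σ R} (hq : i ∉ q.vars) (hp : i ∉ p.vars)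
    (n : ℕ) (m : σ →₀ ℕ) :
    coeff m ((X i + q) ^ n * p) = (n.choose (m i) : R) * coeff (m.erase i) (q ^ (n - m i) * p) := by
  rw [add_pow, Finset.sum_mul, coeff_sum]
  have key : ∀ k ∈ Finset.range (n + 1),
      coeff m (X i ^ k * q ^ (n - k) * (n.choose k : MvPolynomial σ R) * p)
        = if k = m i then (n.choose (m i) : R) * coeff (m.erase i) (q ^ (n - m i) * p) else 0 := by
    intro k _
    have e1 : X i ^ k * q ^ (n - k) * (n.choose k : MvPolynomial σ R) * p
        = C (n.choose k : R) * (monomial (Finsupp.single i k) (1 : R) * (q ^ (n - k) * p)) := by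
      rw [X_pow_eq_monomial, ← C_eq_coe_nat]; ring
    rw [e1, coeff_C_mul, coeff_monomial_mul']
    by_cases hk : k = m i
    · subst hk
      simp [sub_single_self_eq_erase]
    · rw [if_neg hk]
      split_ifs with hle
      · have hlt : k < m i := lt_of_le_of_ne (Finsupp.single_le_iff.mp hle) hk
        have hv : i ∉ (q ^ (n - k) * p).vars := notMem_vars_mul (notMem_vars_pow_and hq _).1 hp
        have hz : coeff (m - Finsupp.single i k) (q ^ (n - k) * p) = 0 := by
          by_contra hne
          have h0 := mem_support_notMem_vars_zero (mem_support_iff.mpr hne) hv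
          simp at h0
          omega
        simp [hz]
      · simp
  rw [Finset.sum_congr rfl key, Finset.sum_ite_eq']
  split_ifs with hmem
  · rfl
  · rw [Finset.mem_range, not_lt] at hmem
    simp [Nat.choose_eq_zero_of_lt (by omega : n < m i)]

/-- The same extraction with a monomial prefix `X i ^ c`. [folklore] -/
theorem coeff_X_pow_mul_X_add_pow_mul (i : σ) {q p : MvPolynomial σ R} (hq : i ∉ q.vars)
    (hp : i ∉ p.vars) (c n : ℕ) (m : σ →₀ ℕ) :
    coeff m (X i ^ c * ((X i + q) ^ n * p)) =
      if c ≤ m i then (n.choose (m i - c) : R) * coeff (m.erase i) (q ^ (n - (m i - c)) * p) else 0 := by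
  rw [X_pow_eq_monomial, coeff_monomial_mul']
  simp only [Finsupp.single_le_iff, one_mul]
  split_ifs with hc
  · rw [coeff_X_add_pow_mul i hq hp]
    have e1 : (m - Finsupp.single i c) i = m i - c := by simp
    have e2 : (m - Finsupp.single i c).erase i = m.erase i := by
      ext j; by_cases h : j = i
      · subst h; simp
      · simp [Finsupp.erase_ne h, Ne.symm h]
    rw [e1, e2]
  · rfl

/-- The coefficient of a pure power of one variable. [folklore] -/
theorem coeff_X_pow_single (i : σ) (N e : ℕ) :
    coeff (Finsupp.single i e) (X i ^ N : MvPolynomial σ R) = if N = e then 1 else 0 := by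
  rw [X_pow_eq_monomial, coeff_monomial]
  simp [Finsupp.single_injective i |>.eq_iff]

/-- The polynomial ring `ℤ[g₀,…,g₅]` of the six finite gaps. -/
abbrev P6 := MvPolynomial (Fin 6) ℤ

/-- The summand of `dualSpanProd A` after the three binomial splits (indices `i ≤ A₇`, `j ≤ A₆`, `l ≤ A₁`). -/
def term (A : Fin 8 → ℕ) (i j l : ℕ) : P6 :=
  (X 0 + X 1) ^ (i + j) * (X 1 ^ l * ((X 1 + X 2) ^ A 0 *
    (X 2 ^ (A 7 - i) * ((X 2 + X 3) ^ (A 6 - j) * ((X 2 + X 3 + X 4) ^ A 3 *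
      (X 2 + X 3 + X 4 + X 5) ^ (A 1 - l + A 2))))))

/-- STEP 1: `dualSpanProd A = Σ_{i,j,l} C(A₇,i)C(A₆,j)C(A₁,l) · term A i j l` (binomial theorem three times). -/
theorem dualSpanProd_eq_sum (A : Fin 8 → ℕ) :
    dualSpanProd A = ∑ i ∈ range (A 7 + 1), ∑ j ∈ range (A 6 + 1), ∑ l ∈ range (A 1 + 1),
      C ((A 7).choose i * ((A 6).choose j * (A 1).choose l) : ℤ) * term A i j l := by
  have h6 : (X 0 + X 1 + X 2 + X 3 : P6) ^ A 6 =
      ∑ j ∈ range (A 6 + 1), (X 0 + X 1) ^ j * (X 2 + X 3) ^ (A 6 - j) * ((A 6).choose j : P6) := by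
    rw [show (X 0 + X 1 + X 2 + X 3 : P6) = (X 0 + X 1) + (X 2 + X 3) by ring, add_pow]
  have h7 : (X 0 + X 1 + X 2 : P6) ^ A 7 =
      ∑ i ∈ range (A 7 + 1), (X 0 + X 1) ^ i * X 2 ^ (A 7 - i) * ((A 7).choose i : P6) := by
    rw [add_pow]
  have h1 : (X 1 + X 2 + X 3 + X 4 + X 5 : P6) ^ A 1 =
      ∑ l ∈ range (A 1 + 1), X 1 ^ l * (X 2 + X 3 + X 4 + X 5) ^ (A 1 - l) * ((A 1).choose l : P6) := by
    rw [show (X 1 + X 2 + X 3 + X 4 + X 5 : P6) = X 1 + (X 2 + X 3 + X 4 + X 5) by ring, add_pow]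
  unfold dualSpanProd
  rw [h6, h7, h1]
  simp only [Finset.sum_mul, Finset.mul_sum]
  refine Finset.sum_congr rfl fun i _ => Finset.sum_congr rfl fun j _ => Finset.sum_congr rfl fun l _ => ?_
  unfold term
  simp only [← C_eq_coe_nat, map_mul]
  ring

/-- The multi-index left after erasing the slots `0,1,5,4,3` is `(m 2)·e₂`. -/
theorem idx_eq (m : Fin 6 →₀ ℕ) :
    ((((m.erase 0).erase 1).erase 5).erase 4).erase 3 = Finsupp.single 2 (m 2) := by
  ext w
  fin_cases w <;> simp

/-- The coefficient of `g^m` in `term A i j l`: five binomial coefficients and two guards (the `g₁`-budget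
`i+j−m₀+l ≤ m₁` and the forced `g₂`-exponent). -/
def termCoeff (A : Fin 8 → ℕ) (m : Fin 6 → ℕ) (i j l : ℕ) : ℤ :=
  ((i + j).choose (m 0) : ℤ) *
    (if i + j - m 0 + l ≤ m 1 then
      ((A 0).choose (m 1 - (i + j - m 0 + l)) : ℤ) *
        (((A 1 - l + A 2).choose (m 5) : ℤ) *
          (((A 1 - l + A 2 - m 5 + A 3).choose (m 4) : ℤ) *
            (((A 1 - l + A 2 - m 5 + A 3 - m 4 + (A 6 - j)).choose (m 3) : ℤ) *
              (if A 1 - l + A 2 - m 5 + A 3 - m 4 + (A 6 - j) - m 3 +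
                    (A 0 - (m 1 - (i + j - m 0 + l)) + (A 7 - i)) = m 2 then 1 else 0))))
    else 0)

/-- STEP 2: `[m] term A i j l = termCoeff A m i j l` — extract `g₀, g₁, g₅, g₄, g₃`, then read off `g₂`. -/
theorem coeff_term (A : Fin 8 → ℕ) (i j l : ℕ) (m : Fin 6 →₀ ℕ) :
    coeff m (term A i j l) = termCoeff A m i j l := by
  unfold term termCoeff
  rw [coeff_X_add_pow_mul (0 : Fin 6) ?_ ?_]
  rotate_left
  · repeat (first
      | with_reducible exact (notMem_vars_X_and (by decide)).1
      | with_reducible apply notMem_vars_mul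
      | with_reducible refine (notMem_vars_pow_and ?_ _).1
      | with_reducible apply notMem_vars_add)
  · repeat (first
      | with_reducible exact (notMem_vars_X_and (by decide)).1
      | with_reducible apply notMem_vars_mul
      | with_reducible refine (notMem_vars_pow_and ?_ _).1
      | with_reducible apply notMem_vars_add)
  rw [← mul_assoc, ← pow_add]
  rw [coeff_X_pow_mul_X_add_pow_mul (1 : Fin 6) ?_ ?_]
  rotate_left
  · repeat (first
      | with_reducible exact (notMem_vars_X_and (by decide)).1
      | with_reducible apply notMem_vars_mul
      | with_reducible refine (notMem_vars_pow_and ?_ _).1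
      | with_reducible apply notMem_vars_add)
  · repeat (first
      | with_reducible exact (notMem_vars_X_and (by decide)).1
      | with_reducible apply notMem_vars_mul
      | with_reducible refine (notMem_vars_pow_and ?_ _).1
      | with_reducible apply notMem_vars_add)
  have hm1 : (m.erase 0) 1 = m 1 := Finsupp.erase_ne (by decide)
  rw [hm1]
  congr 1
  by_cases hc : i + j - m 0 + l ≤ m 1
  · rw [if_pos hc, if_pos hc]
    congr 1
    set e := A 0 - (m 1 - (i + j - m 0 + l)) with he
    rw [show (X 2 ^ e * (X 2 ^ (A 7 - i) * ((X 2 + X 3) ^ (A 6 - j) * ((X 2 + X 3 + X 4) ^ A 3 *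
        (X 2 + X 3 + X 4 + X 5) ^ (A 1 - l + A 2)))) : P6) =
        (X 5 + (X 2 + X 3 + X 4)) ^ (A 1 - l + A 2) *
          (X 2 ^ e * (X 2 ^ (A 7 - i) * ((X 2 + X 3) ^ (A 6 - j) * (X 2 + X 3 + X 4) ^ A 3))) by ring]
    rw [coeff_X_add_pow_mul (5 : Fin 6) ?_ ?_]
    rotate_left
    · repeat (first
        | with_reducible exact (notMem_vars_X_and (by decide)).1
        | with_reducible apply notMem_vars_mul
        | with_reducible refine (notMem_vars_pow_and ?_ _).1
        | with_reducible apply notMem_vars_add)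
    · repeat (first
        | with_reducible exact (notMem_vars_X_and (by decide)).1
        | with_reducible apply notMem_vars_mul
        | with_reducible refine (notMem_vars_pow_and ?_ _).1
        | with_reducible apply notMem_vars_add)
    have hm5 : ((m.erase 0).erase 1) 5 = m 5 := by simp
    rw [hm5]
    congr 1
    rw [show ((X 2 + X 3 + X 4) ^ (A 1 - l + A 2 - m 5) *
        (X 2 ^ e * (X 2 ^ (A 7 - i) * ((X 2 + X 3) ^ (A 6 - j) * (X 2 + X 3 + X 4) ^ A 3))) : P6) =
        (X 4 + (X 2 + X 3)) ^ (A 1 - l + A 2 - m 5 + A 3) *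
          (X 2 ^ e * (X 2 ^ (A 7 - i) * (X 2 + X 3) ^ (A 6 - j))) by ring]
    rw [coeff_X_add_pow_mul (4 : Fin 6) ?_ ?_]
    rotate_left
    · repeat (first
        | with_reducible exact (notMem_vars_X_and (by decide)).1
        | with_reducible apply notMem_vars_mul
        | with_reducible refine (notMem_vars_pow_and ?_ _).1
        | with_reducible apply notMem_vars_add)
    · repeat (first
        | with_reducible exact (notMem_vars_X_and (by decide)).1
        | with_reducible apply notMem_vars_mul
        | with_reducible refine (notMem_vars_pow_and ?_ _).1
        | with_reducible apply notMem_vars_add)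
    have hm4 : (((m.erase 0).erase 1).erase 5) 4 = m 4 := by simp
    rw [hm4]
    congr 1
    rw [show ((X 2 + X 3) ^ (A 1 - l + A 2 - m 5 + A 3 - m 4) *
        (X 2 ^ e * (X 2 ^ (A 7 - i) * (X 2 + X 3) ^ (A 6 - j))) : P6) =
        (X 3 + X 2) ^ (A 1 - l + A 2 - m 5 + A 3 - m 4 + (A 6 - j)) * (X 2 ^ e * X 2 ^ (A 7 - i)) by ring]
    rw [coeff_X_add_pow_mul (3 : Fin 6) ?_ ?_]
    rotate_left
    · repeat (first
        | with_reducible exact (notMem_vars_X_and (by decide)).1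
        | with_reducible apply notMem_vars_mul
        | with_reducible refine (notMem_vars_pow_and ?_ _).1
        | with_reducible apply notMem_vars_add)
    · repeat (first
        | with_reducible exact (notMem_vars_X_and (by decide)).1
        | with_reducible apply notMem_vars_mul
        | with_reducible refine (notMem_vars_pow_and ?_ _).1
        | with_reducible apply notMem_vars_add)
    have hm3 : ((((m.erase 0).erase 1).erase 5).erase 4) 3 = m 3 := by simp
    rw [hm3, idx_eq]
    congr 1
    rw [show (X 2 ^ (A 1 - l + A 2 - m 5 + A 3 - m 4 + (A 6 - j) - m 3) * (X 2 ^ e * X 2 ^ (A 7 - i)) : P6)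
        = X 2 ^ (A 1 - l + A 2 - m 5 + A 3 - m 4 + (A 6 - j) - m 3 + (e + (A 7 - i))) by ring]
    rw [coeff_X_pow_single]
  · rw [if_neg hc, if_neg hc]

/-- **The closed 3-fold form** of the coefficient of `g^B` in `dualSpanProd A`. -/
def ctSum (A : Fin 8 → ℕ) (B : Fin 6 → ℕ) : ℤ :=
  ∑ i ∈ range (A 7 + 1), ∑ j ∈ range (A 6 + 1), ∑ l ∈ range (A 1 + 1),
    ((A 7).choose i * ((A 6).choose j * (A 1).choose l) : ℤ) * termCoeff A B i j l

/-- **`[g^m] dualSpanProd A = ctSum A m`** for every exponent vector `A` and every monomial `m`. -/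
theorem coeff_dualSpanProd (A : Fin 8 → ℕ) (m : Fin 6 →₀ ℕ) :
    coeff m (dualSpanProd A) = ctSum A m := by
  rw [dualSpanProd_eq_sum]
  simp only [coeff_sum, coeff_C_mul, coeff_term]
  rfl

/-- The same with the monomial given as a function `B : Fin 6 → ℕ`. -/
theorem coeff_dualSpanProd' (A : Fin 8 → ℕ) (B : Fin 6 → ℕ) :
    coeff (Finsupp.equivFunOnFinite.symm B) (dualSpanProd A) = ctSum A B := by
  rw [coeff_dualSpanProd]
  simp

/-- Every `termCoeff` is non-negative. -/
theorem termCoeff_nonneg (A : Fin 8 → ℕ) (B : Fin 6 → ℕ) (i j l : ℕ) : 0 ≤ termCoeff A B i j l := by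
  unfold termCoeff
  split_ifs <;> positivity

/-- `ctSum ≥ 0`. -/
theorem ctSum_nonneg (A : Fin 8 → ℕ) (B : Fin 6 → ℕ) : 0 ≤ ctSum A B := by
  unfold ctSum
  refine Finset.sum_nonneg fun i _ => Finset.sum_nonneg fun j _ => Finset.sum_nonneg fun l _ => ?_
  exact mul_nonneg (by positivity) (termCoeff_nonneg A B i j l)

/-- All coefficients of `dualSpanProd A` are non-negative (a product of sums of variables). -/
theorem coeff_dualSpanProd_nonneg (A : Fin 8 → ℕ) (m : Fin 6 →₀ ℕ) : 0 ≤ coeff m (dualSpanProd A) := by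
  rw [coeff_dualSpanProd]; exact ctSum_nonneg _ _

/-- For an integer polynomial with non-negative coefficients and a point `g ≥ 0`, one term of the evaluation is
bounded by the whole: `[m]p · g^m ≤ p(g)`. [folklore] -/
theorem coeff_mul_prod_le_eval₂ {τ : Type*} [Fintype τ] (p : MvPolynomial τ ℤ) (hp : ∀ d, 0 ≤ coeff d p)
    (g : τ → ℝ) (hg : ∀ i, 0 ≤ g i) (m : τ →₀ ℕ) :
    ((coeff m p : ℤ) : ℝ) * ∏ i, g i ^ m i ≤ p.eval₂ (Int.castRingHom ℝ) g := by
  rw [eval₂_eq']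
  have hnn : ∀ d ∈ p.support, (0 : ℝ) ≤ (Int.castRingHom ℝ) (coeff d p) * ∏ i, g i ^ d i := fun d _ =>
    mul_nonneg (by have := hp d; simp only [eq_intCast]; exact_mod_cast this)
      (Finset.prod_nonneg fun i _ => pow_nonneg (hg i) _)
  by_cases hm : m ∈ p.support
  · simpa using Finset.single_le_sum hnn hm
  · rw [notMem_support_iff.mp hm]
    simpa using Finset.sum_nonneg hnn

/-- `(n · x).toNat = n · x.toNat` for `x ≥ 0`. [folklore] -/
theorem toNat_natCast_mul_of_nonneg {n : ℕ} {x : ℤ} (hx : 0 ≤ x) : ((n : ℤ) * x).toNat = n * x.toNat := by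
  obtain ⟨k, rfl⟩ := Int.eq_ofNat_of_zero_le hx
  rw [← Nat.cast_mul, Int.toNat_natCast, Int.toNat_natCast]

/-- Scaling the exponents scales the polynomial to a power: `dualSpanProd (n·A) = (dualSpanProd A)ⁿ`. -/
theorem dualSpanProd_smul (n : ℕ) (A : Fin 8 → ℕ) : dualSpanProd (fun i => n * A i) = dualSpanProd A ^ n := by
  unfold dualSpanProd
  simp only [pow_mul']
  ring

end DualCT

end Summit.KontsevichZagierPeriods.Zeta5Search.Families.Cellular
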